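import Literature.MathematicalPhysics.QuantumLattice.FinDimSpectrum
import Literature.MathematicalPhysics.QuantumLattice.HeisenbergModel
import Literature.MathematicalPhysics.QuantumLattice.KagomeLattice
import Literature.MathematicalPhysics.QuantumLattice.SpinLiquid
import HarnessLib
import HarnessLib.Audit

-- provenance: harness21/H21/H21/Statements/Hubbard/SpinLiquid.lean @ acfe20e (interim HEAD d8f2665); M5 mechanical rewrite
/-!
# The kagome spin liquid (family `hubbard`, S03 and S24)

Trunk QLatticeAQFT / family `hubbard`, statements **hubbard.S03** (the spin-1/2 kagome
Heisenberg antiferromagnet is a quantum spin liquid — *open*, competing numerics) and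
**hubbard.S24** (the working definition of a quantum spin liquid, definition role, flagged
ambiguous in print).

The setting is the H21 working definition of `Literature.Prelude.QLatticeAQFT.SpinLiquid`
(outline decision Q-D7): state families on the decorated discrete tori
`StatMech.TorusSite d L × κ`. The kagome torus of `Literature.Prelude.QLatticeAQFT.KagomeLattice` is
*literally* an instance, `KagomeTorusVertex L = TorusSite 2 L × Fin 3` (unit cell `κ = Fin 3`,
`d = 2`), so no adapters are needed.

## Contents

* `kagomeHeisenberg L = Σ_{⟨a,b⟩ ∈ kagome torus} 𝐒_a · 𝐒_b`, the spin-1/2 (`n = 1`, local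
  dimension `q = 2`) antiferromagnetic (`J = 1`) Heisenberg Hamiltonian on the kagome torus with
  `L × L` unit cells (`heisenbergHamiltonian 1 (kagomeTorusGraph L) 1`), and its tracial
  ground-state functional `kagomeGroundState L = Matrix.groundStateFunctional (kagomeHeisenberg L)`;
  both as families indexed by *all* `L : ℕ` with documented junk value `0` at `L = 0`
  (`Fintype (ZMod 0)` fails), unfolded by `kagomeHeisenberg_of_neZero`,
  `kagomeGroundState_of_neZero`.
* **hubbard.S24** `isSpinLiquid_iff_odd_and`: the working definition `IsSpinLiquid n ω H`
  unfolded into its four clauses (half-odd-integer spin per unit cell `Odd (card κ * n)`; no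
  long-range order for any local order parameter; translation and `SU(2)` symmetry; gapped topological phase or
  algebraic decay). Proved by `Iff.rfl`.
* **hubbard.S03** `KagomeSpinLiquid` (weak reading: no long-range order for any local order
  parameter in the ground states of the kagome antiferromagnet) and `KagomeGappedZ2SpinLiquid`
  (strong reading: a gapped `ℤ₂` spin liquid with fourfold topological degeneracy on the torus).
  Both are registered **OPEN CONJECTURES** (`def … : Prop`, docstrings `OPEN CONJECTURE — …
  [status: open]`, CONVENTIONS §4), stated and never asserted — see "Status of hubbard.S03"
  below. `KagomeGappedZ2SpinLiquid.kagomeSpinLiquid` (alias `kagomeSpinLiquid_of_gapped`) is the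
  sanity implication strong ⇒ weak.

## Sources

* S. Yan, D. A. Huse, S. R. White, *Spin-liquid ground state of the `S = 1/2` kagome Heisenberg
  antiferromagnet*, Science **332** (2011) 1173 (DMRG evidence for a gapped `ℤ₂` liquid).
* L. Savary, L. Balents, *Quantum spin liquids: a review*, Rep. Prog. Phys. **80** (2017)
  016502 = arXiv:1601.03742 (section and page numbers below are those of arXiv v1): §1–2 (what
  is a spin liquid; §2.1 p. 4: the fourfold, locally indistinguishable topological degeneracy of
  the toric code on the torus, eq. (4)), §4.3 and §5.4 (`ℤ₂` liquids), §5.1 pp. 24–25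
  (Lieb–Schultz–Mattis–Hastings constraints for half-odd-integer spin per unit cell), §6.4.2
  pp. 36–37 (kagomé models: "remains controversial today", "the presence of a gapped `ℤ₂` QSL in
  the nearest-neighbor kagomé system and even `J₁`–`J₂` model remains an open issue").
* M. R. Norman, *Herbertsmithite and the search for the quantum spin liquid*, Rev. Mod. Phys.
  **88** (2016) 041002.
* M. B. Hastings, *Lieb–Schultz–Mattis in higher dimensions*, PRB **69** (2004) 104431.
* J. Knolle, R. Moessner, Ann. Rev. Cond. Mat. Phys. **10** (2019) 451, §1–2.

## Status of hubbard.S03: registered OPEN CONJECTURES, not literature debt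

Verdict clean-up 2026-08-15. Two tenured prove-seats audited `KagomeSpinLiquid` and
`KagomeGappedZ2SpinLiquid` against the source and returned `open problem`; the verdicts were
re-verified here against the printed text of Savary–Balents, arXiv:1601.03742v1 §6.4.2,
pp. 36–37: the nearest-neighbour spin-1/2 kagome antiferromagnet "has a tumultuous past and
remains controversial today"; the DMRG results (Yan–Huse–White 2011; Depenbrock–McCulloch–
Schollwöck 2012; Jiang–Wang–Balents 2012, topological entanglement entropy `ln 2`) "point
strongly toward a gapped `ℤ₂` QSL ground state", while "a gapless `U(1)` QSL state continues to be
advocated", "Hence, the presence of a gapped `ℤ₂` QSL in the nearest-neighbor kagomé system and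
even `J₁`–`J₂` model remains an open issue". All the evidence either way is numerical or
variational; no theorem excluding long-range order (of any local order parameter) in the ground
states of this model is in print, let alone one establishing `ℤ₂` topological order. Hence
neither `KagomeSpinLiquid_holds` nor `KagomeGappedZ2SpinLiquid_holds` can be expected short of
settling the physics question itself: both docstrings now begin `OPEN CONJECTURE —`, name where
the conjecture is posed, and carry `[status: open]`; the Lean statements are byte-for-byte
unchanged. The NAMES ARE KEPT (not renamed `…Conjecture`): both are used in this file by the
proved relations `KagomeGappedZ2SpinLiquid.kagomeSpinLiquid`, `kagomeSpinLiquid_of_gapped`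
(outline name) and `KagomeGappedZ2SpinLiquid.isSpinLiquid`, and a verdict clean-up seat may not
declare new closed `Prop` names (D-0026). A conditional development takes
`(h : KagomeSpinLiquid)` / `(h : KagomeGappedZ2SpinLiquid)` as an explicit hypothesis.

## Mathlib / H21 search and design notes

* Mathlib: `rg -i "kagome|spin liquid|Heisenberg model|order parameter"` over Mathlib finds
  nothing relevant; everything below is assembled from accepted H21 preludes:
  `heisenbergHamiltonian` (`HeisenbergModel`), `kagomeTorusGraph`, `KagomeTorusVertex`
  (`KagomeLattice`), `Matrix.groundStateFunctional` (`FinDimSpectrum`), `IsSpinLiquid`,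
  `IsGappedSpinLiquid`, `IsGappedTopologicalPhase`, `HasNoLongRangeOrder`, `LocalOrderParameter`,
  `IsSymmetricFamily`, `HasAlgebraicDecay` (`SpinLiquid`), `TorusSite` (`LatticeGraph`).
* **Junk values at `L = 0`.** The family predicates of `SpinLiquid` take `ω : ∀ L, …` indexed
  by all `L : ℕ` and only ever evaluate them under `[NeZero L]`; the kagome Hamiltonian and
  ground state need `Fintype (KagomeTorusVertex L)`, i.e. `L ≠ 0`, so both are defined by
  `if L = 0 then 0 else …`, exactly as `spinSpinCorrTorus` in
  `Literature.Statements.Hubbard.HeisenbergOrder`.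
* **Strong reading, `m = 4`.** `IsGappedSpinLiquid` only asks for *some* topological degeneracy
  `m ≥ 2`; the `ℤ₂` (toric-code) liquid proposed for kagome has `m = 4` ground states on the
  torus (Savary–Balents §2.1, eq. (4)), so `KagomeGappedZ2SpinLiquid` is the conjunction of
  `IsGappedSpinLiquid 1 ω H` with `IsGappedTopologicalPhase H 4`.
* Point-group (lattice rotation/reflection) and time-reversal symmetry are deliberately *not*
  part of `IsSymmetricFamily` (stated simplification of Q-D7); recorded in the S24 docstring.
* `isSpinLiquid_iff_odd_and` is the clause-by-clause unfolding carrying the S24 id (named so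
  as not to clash with `Literature.MathematicalPhysics.QuantumLattice.isSpinLiquid_iff`, gapped ∨ gapless, a different lemma).
* `IsGappedTopologicalPhase H 4` quantifies over *all* `L ≥ 1`, so the strong reading demands
  the fourfold degeneracy also on odd-`L` tori (odd number `3L²` of spins) and on the degenerate
  `L = 1, 2` tori; "fourfold" is the even-`L` count in the physics literature, so the strong
  reading is correspondingly strict (architect's prescription `m = 4`, recorded here).
-/

noncomputable section

open Matrix

namespace Literature.MathematicalPhysics.QuantumLattice

open Literature.Probability.LatticeModels Literature.Probability.Percolation

/-! ### The kagome Heisenberg antiferromagnet on tori -/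

/-- The spin-1/2 antiferromagnetic **kagome Heisenberg Hamiltonian** on the kagome torus with
`L × L` unit cells, `H_L = Σ_{⟨a,b⟩} 𝐒_a · 𝐒_b` (`J = 1`, spin `n/2 = 1/2`, local dimension `2`),
i.e. `heisenbergHamiltonian 1 (kagomeTorusGraph L) 1` on `KagomeTorusVertex L = (ℤ/Lℤ)² × Fin 3`.
**Junk value** `0` at `L = 0` (the vertex type is then infinite); see
`kagomeHeisenberg_of_neZero`. Yan–Huse–White, Science 332 (2011) 1173, eq. (1);
Savary–Balents (2017) §6.4.2 (arXiv:1601.03742v1 p. 36). [cite: SavaryBalents2017, §6.4.2] -/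
def kagomeHeisenberg (L : ℕ) : Op (KagomeTorusVertex L) 2 :=
  if hL : L = 0 then 0
  else
    haveI : NeZero L := ⟨hL⟩
    heisenbergHamiltonian 1 (kagomeTorusGraph L) 1

/-- Unfolding `kagomeHeisenberg` on a genuine torus (`L ≠ 0`). Yan–Huse–White (2011), eq. (1). [cite: YanHuseWhite2011] -/
theorem kagomeHeisenberg_of_neZero (L : ℕ) [NeZero L] :
    kagomeHeisenberg L = heisenbergHamiltonian 1 (kagomeTorusGraph L) 1 := by
  simp [kagomeHeisenberg, NeZero.ne L]

/-- The kagome Heisenberg Hamiltonian is Hermitian. Tasaki (2020) §2.4. [cite: Tasaki2020] -/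
theorem kagomeHeisenberg_isHermitian (L : ℕ) : (kagomeHeisenberg L).IsHermitian := by
  unfold kagomeHeisenberg
  split_ifs with hL
  · exact isHermitian_zero
  · haveI : NeZero L := ⟨hL⟩
    exact heisenbergHamiltonian_isHermitian 1 _ 1

/-- The (tracial) **ground-state functional** of the kagome Heisenberg antiferromagnet on the
torus with `L × L` unit cells, `O ↦ tr (P₀ O) / tr P₀` with `P₀` the ground-space projection of
`kagomeHeisenberg L` (`Matrix.groundStateFunctional`; the uniform mixture of the finite-volume
ground states). **Junk value** `0` at `L = 0`; see `kagomeGroundState_of_neZero`.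
Yan–Huse–White (2011); Tasaki (2020) §2.1. [cite: YanHuseWhite2011] -/
def kagomeGroundState (L : ℕ) : Op (KagomeTorusVertex L) 2 →ₗ[ℂ] ℂ :=
  if hL : L = 0 then 0
  else
    haveI : NeZero L := ⟨hL⟩
    Matrix.groundStateFunctional (kagomeHeisenberg L)

/-- Unfolding `kagomeGroundState` on a genuine torus (`L ≠ 0`). Tasaki (2020) §2.1. [cite: Tasaki2020] -/
theorem kagomeGroundState_of_neZero (L : ℕ) [NeZero L] :
    kagomeGroundState L = Matrix.groundStateFunctional (kagomeHeisenberg L) := by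
  simp [kagomeGroundState, NeZero.ne L]

/-- The kagome setting satisfies the half-odd-integer-spin-per-unit-cell clause of the working
definition: three spins `1/2` per unit cell, `Odd (card (Fin 3) * 1)`. Hastings, PRB 69 (2004)
104431; Savary–Balents (2017) §5.1 (arXiv:1601.03742v1 pp. 24–25, "LSM" constraints).
[cite: SavaryBalents2017, §5.1] -/
theorem odd_card_kagomeCell : Odd (Fintype.card (Fin 3) * 1) := by
  decide

/-! ### hubbard.S24: the working definition of a quantum spin liquid -/

/-- **hubbard.S24** (quantum spin liquid — **H21 working definition (outline Q-D7); ambiguous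
in print; point-group symmetry deliberately omitted**). For spin `n/2` on the decorated tori
`(ℤ/Lℤ)^d × κ` (unit cell `κ`), a family of states `ω L` with Hamiltonians `H L` is a quantum
spin liquid (`IsSpinLiquid n ω H`) iff
(i) the spin per unit cell is half-odd-integer, `Odd (card κ · n)` (Hastings' higher-dimensional
Lieb–Schultz–Mattis setting: a featureless gapped unique ground state is then impossible);
(ii) no local order parameter `O` has long-range order, `S_L(k_L) → 0` for every sequence of
ordering vectors (`HasNoLongRangeOrder`: no Néel, spiral, valence-bond-crystal or chiral
order);
(iii) `ω` breaks no lattice-translation or spin-rotation symmetry (`IsSymmetricFamily`;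
lattice point-group and time-reversal symmetry are *not* required — stated simplification); and
(iv) [gapped reading] `H` is in a gapped phase with topological ground-state degeneracy
`m ≥ 2` on tori not distinguishable by local operators (LTQO, `IsGappedTopologicalPhase`), or
[gapless reading] every local order parameter has algebraically decaying correlations
(`HasAlgebraicDecay`).
Savary–Balents, Rep. Prog. Phys. 80 (2017) 016502, §2; Hastings, PRB 69 (2004) 104431;
Knolle–Moessner (2019) §1–2. There is no canonical definition in print. [cite: KnolleMoessner2019] -/
theorem isSpinLiquid_iff_odd_and {d : ℕ} {κ : Type*} [Fintype κ] [DecidableEq κ] (n : ℕ)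
    (ω : ∀ L, Op (TorusSite d L × κ) (n + 1) →ₗ[ℂ] ℂ)
    (H : ∀ L, Op (TorusSite d L × κ) (n + 1)) :
    IsSpinLiquid n ω H ↔
      Odd (Fintype.card κ * n) ∧
        (∀ O : LocalOrderParameter d κ (n + 1), HasNoLongRangeOrder ω O) ∧
          IsSymmetricFamily ω ∧
            ((∃ m, 2 ≤ m ∧ IsGappedTopologicalPhase H m) ∨
              ∀ O : LocalOrderParameter d κ (n + 1), HasAlgebraicDecay ω O) :=
  Iff.rfl

/-! ### hubbard.S03: the kagome antiferromagnet is a spin liquid (open) -/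

/-- OPEN CONJECTURE — **hubbard.S03** (kagome spin liquid, *weak reading*): the ground states of
the spin-1/2 nearest-neighbour Heisenberg antiferromagnet on the kagome lattice have no
long-range order of any kind. Posed by Elser, PRL 62 (1989) 2405 (non-magnetic ground state) and
Sachdev, PRB 45 (1992) 12377 (a quantum spin liquid) — refs. [75], [76] of Savary–Balents — and
sharpened by the DMRG study of Yan–Huse–White, Science 332 (2011) 1173 (abstract: a spin
liquid is a state "in which quantum fluctuations have melted away any form of magnetic order";
DMRG finds "instead of the valence bond crystal a singlet-gapped spin liquid"); recorded as OPEN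
in Savary–Balents, Rep. Prog. Phys. 80 (2017) 016502, §6.4.2
(arXiv:1601.03742v1 pp. 36–37: the nearest-neighbour model "has a tumultuous past and remains
controversial today"; all evidence is numerical/variational — exact diagonalisation, series,
DMRG, projected wavefunctions — and no theorem excluding order in this model is in print); see
also Norman, Rev. Mod. Phys. 88 (2016) 041002. [cite: SavaryBalents2017, §6.4.2] [status: open] —
no `KagomeSpinLiquid_holds` is to be expected; never assert it, take `(h : KagomeSpinLiquid)` as
an explicit hypothesis. Verdict clean-up 2026-08-15: audited against the printed text, open
problem; name (in-file users, D-0026) and statement unchanged.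
Statement (H21 rendering, fixed order-parameter list = *all* local order parameters): for every
`O : LocalOrderParameter 2 (Fin 3) 2` (any observable on a decorated box of `ℤ² × Fin 3`, e.g. a
site spin, a bond energy, a scalar chirality) the structure factor of `O` in the torus
ground-state functionals `kagomeGroundState L` tends to zero along every sequence of ordering
vectors as `L → ∞` (`HasNoLongRangeOrder`): no magnetic/Néel, valence-bond-crystal or chiral
order in the thermodynamic limit. -/
@[conjecture] def KagomeSpinLiquid : Prop :=
  ∀ O : LocalOrderParameter 2 (Fin 3) 2, HasNoLongRangeOrder (fun L => kagomeGroundState L) O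

/-- OPEN CONJECTURE — **hubbard.S03** (kagome spin liquid, *strong reading*: gapped `ℤ₂`
topological order): the ground state of the spin-1/2 nearest-neighbour kagome Heisenberg
antiferromagnet is a gapped `ℤ₂` (toric-code) quantum spin liquid. Posed by the DMRG study of
Yan–Huse–White, Science 332 (2011) 1173 (abstract: "a singlet-gapped spin liquid … that appears
to have `ℤ₂` topological order … strong evidence that the 2D ground state of this model is a
gapped spin liquid"), supported by Depenbrock–McCulloch–Schollwöck (2012) and Jiang–Wang–Balents
(2012) (refs. [80], [2] of Savary–Balents); recorded as OPEN in Savary–Balents, Rep. Prog. Phys.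
80 (2017) 016502, §6.4.2 (arXiv:1601.03742v1 p. 37: "a gapless `U(1)` QSL state continues to be
advocated [88, 89, 82] … Hence, the presence of a gapped `ℤ₂` QSL in the nearest-neighbor kagomé
system and even `J₁`–`J₂` model remains an open issue"); the fourfold, locally indistinguishable
torus degeneracy of a `ℤ₂` liquid is that of the toric code, ibid. §2.1 p. 4, eq. (4).
[cite: SavaryBalents2017, §6.4.2] [status: open] — no `KagomeGappedZ2SpinLiquid_holds` is to be
expected; never assert it, take `(h : KagomeGappedZ2SpinLiquid)` as an explicit hypothesis.
Verdict clean-up 2026-08-15: audited against the printed text, open problem; name (in-file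
users, D-0026) and statement unchanged.
Statement (H21 rendering): the ground states `kagomeGroundState L` of `kagomeHeisenberg L` form a
gapped spin liquid in the sense of the H21 working definition (`IsGappedSpinLiquid 1`:
half-odd-integer spin per unit cell, no long-range order for any local order parameter,
translation and `SU(2)` symmetry, a uniform cluster gap above locally indistinguishable
quasi-degenerate ground states) with the fourfold topological ground-state degeneracy on the
torus of a `ℤ₂` (toric-code) liquid, `IsGappedTopologicalPhase (kagomeHeisenberg ·) 4` (demanded
for *all* `L ≥ 1`, including odd `L`; "fourfold" is the even-`L` count of the physics
literature, so this reading is strict). -/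
@[conjecture] def KagomeGappedZ2SpinLiquid : Prop :=
  IsGappedSpinLiquid 1 (fun L => kagomeGroundState L) (fun L => kagomeHeisenberg L) ∧
    IsGappedTopologicalPhase (fun L => kagomeHeisenberg L) 4

/-- Sanity implication: the strong (gapped `ℤ₂`) reading of the kagome spin-liquid conjecture
implies the weak (no long-range order) reading (both open; this implication is all that is
proved here). H21 working definition; Savary–Balents (2017) §1–2. [cite: SavaryBalents2017, §2] -/
theorem KagomeGappedZ2SpinLiquid.kagomeSpinLiquid (h : KagomeGappedZ2SpinLiquid) :
    KagomeSpinLiquid :=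
  h.1.2.1

/-- Sanity implication strong ⇒ weak reading (outline name; alias of
`KagomeGappedZ2SpinLiquid.kagomeSpinLiquid`). H21 working definition; Savary–Balents (2017)
§1–2. [cite: SavaryBalents2017, §2] -/
theorem kagomeSpinLiquid_of_gapped (h : KagomeGappedZ2SpinLiquid) : KagomeSpinLiquid :=
  h.kagomeSpinLiquid

/-- The strong reading makes the kagome antiferromagnet a spin liquid in the sense of the
working definition **hubbard.S24** (`IsSpinLiquid 1`). H21 working definition;
Savary–Balents (2017) §1–2. [cite: SavaryBalents2017, §2] -/
theorem KagomeGappedZ2SpinLiquid.isSpinLiquid (h : KagomeGappedZ2SpinLiquid) :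
    IsSpinLiquid 1 (fun L => kagomeGroundState L) (fun L => kagomeHeisenberg L) :=
  h.1.isSpinLiquid

end Literature.MathematicalPhysics.QuantumLattice
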